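import Mathlib
import Literature.AlgebraicGeometry.Tropical.InitialIdeal
import Literature.AlgebraicGeometry.Tropical.TropicalLink

/-!
# TropicalLinks / InductiveStep — a nonzero weight is a positive multiple of the first coordinate
# of a lattice splitting (Gröbner dictionary, brick B6)

Route `ResolutionOfSingularities/TropicalLinks`, crux `InductiveStep`
(stmt-ResolutionOfSingularities-17233), line `split`, in support of stub `stub_sncClosureSchon`.

The Gröbner dictionary "`in_w(I)` regular ⟺ the special fibre of a partial compactification is
regular" is set up along the FIRST COORDINATE of a split lattice `ℤ × K` (brick
`TropicalLinksInductiveStepRayDegeneration`) and transported along lattice isomorphisms (brick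
`TropicalLinksInductiveStepDomCongr`). This file supplies the lattice-theoretic input which reduces
an arbitrary nonzero integer weight `w ∈ ℤ^n` to that situation:

* `tropicalLinks_exists_addEquiv_prod_ker` — a unimodular functional `φ : M →+ ℤ` (one with
  `φ v₀ = 1` for some `v₀`) is the first coordinate of the splitting `M ≃+ ℤ × ker φ`,
  `v ↦ (φ v, v - φ v • v₀)`, with inverse `(a, κ) ↦ a • v₀ + κ`;
* `tropicalLinks_exists_pos_mul_primitive_dotWeight` — every nonzero `w ∈ ℤ^n` satisfies
  `⟨w, ·⟩ = ℓ · ⟨w₀, ·⟩` with `ℓ > 0` and `w₀` primitive, i.e. `⟨w₀, v₀⟩ = 1` for some `v₀`: the range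
  of `⟨w, ·⟩ : ℤ^n →+ ℤ` is a nonzero subgroup of `ℤ`, hence cyclic, `= ℤ ℓ` with `ℓ > 0` a value
  `⟨w, v₀⟩`; `ℓ` divides every `wᵢ = ⟨w, eᵢ⟩`, and `w₀ := w / ℓ`;
* `tropicalLinks_exists_addEquiv_fst_eq_dotWeight` (the registered brick B6) — hence for `w ≠ 0`
  there are `ℓ > 0`, an abelian group `K` (`= ker ⟨w₀, ·⟩ ≅ ℤ^{n-1}`) and a splitting
  `e : ℤ^n ≃+ ℤ × K` with `ℓ · (e v).1 = ⟨w, v⟩` for all `v ∈ ℤ^n`.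

Elementary algebra of subgroups of `ℤ` (`Int.subgroup_cyclic`); no new definitions.
-/

set_option linter.dupNamespace false -- single-conjunct summit: doubled namespace component is mandated

namespace Summit.ResolutionOfSingularities.ResolutionOfSingularities.Theorems

open Literature.AlgebraicGeometry.Tropical

/-- **A unimodular functional splits off a copy of `ℤ`**: if `φ : M →+ ℤ` takes the value `1` at
`v₀`, then `v ↦ (φ v, v - φ v • v₀)` is an isomorphism `M ≃+ ℤ × ker φ` (with inverse
`(a, κ) ↦ a • v₀ + κ`) whose first coordinate is `φ`. [folklore] -/
theorem tropicalLinks_exists_addEquiv_prod_ker {M : Type*} [AddCommGroup M] (φ : M →+ ℤ) (v₀ : M)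
    (h : φ v₀ = 1) : ∃ e : M ≃+ ℤ × φ.ker, ∀ v, (e v).1 = φ v := by
  have hker : ∀ v, v - φ v • v₀ ∈ φ.ker := fun v => by
    simp [AddMonoidHom.mem_ker, h]
  refine ⟨{ toFun := fun v => (φ v, ⟨v - φ v • v₀, hker v⟩)
            invFun := fun p => p.1 • v₀ + (p.2 : M)
            left_inv := fun v => add_sub_cancel (φ v • v₀) v
            right_inv := ?_
            map_add' := ?_ }, fun v => rfl⟩
  · rintro ⟨a, κ, hκ⟩
    have hφ : φ (a • v₀ + κ) = a := by
      rw [map_add, map_zsmul, h, AddMonoidHom.mem_ker.mp hκ, smul_eq_mul, mul_one, add_zero]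
    refine Prod.ext hφ (Subtype.ext ?_)
    show a • v₀ + κ - φ (a • v₀ + κ) • v₀ = κ
    rw [hφ, add_sub_cancel_left]
  · intro u v
    refine Prod.ext (map_add φ u v) (Subtype.ext ?_)
    show u + v - φ (u + v) • v₀ = (u - φ u • v₀) + (v - φ v • v₀)
    rw [map_add, add_smul]
    abel

/-- **Every nonzero integer weight is a positive multiple of a primitive one**: for `w ≠ 0` in
`ℤ^n` there are `ℓ > 0` and `w₀, v₀ ∈ ℤ^n` with `ℓ · ⟨w₀, v⟩ = ⟨w, v⟩` for all `v` and `⟨w₀, v₀⟩ = 1`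
(the range of `⟨w, ·⟩` is a nonzero subgroup `ℤ ℓ ≤ ℤ`, and `ℓ ∣ wᵢ = ⟨w, eᵢ⟩`). [folklore] -/
theorem tropicalLinks_exists_pos_mul_primitive_dotWeight {n : ℕ} {w : Fin n → ℤ} (hw : w ≠ 0) :
    ∃ (ℓ : ℤ) (w₀ v₀ : Fin n → ℤ),
      0 < ℓ ∧ (∀ v, ℓ * dotWeight w₀ v = dotWeight w v) ∧ dotWeight w₀ v₀ = 1 := by
  classical
  obtain ⟨a, ha⟩ := Int.subgroup_cyclic (dotWeightHom w).range
  -- every weight `⟨w, v⟩` is a multiple of `|a|`,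
  have hdvd : ∀ v, |a| ∣ dotWeight w v := fun v => by
    have hv : dotWeight w v ∈ AddSubgroup.closure {a} := by
      rw [← ha]
      exact ⟨v, rfl⟩
    obtain ⟨m, hm⟩ := AddSubgroup.mem_closure_singleton.mp hv
    exact (abs_dvd a _).mpr ⟨m, by rw [← hm, smul_eq_mul, mul_comm]⟩
  -- in particular so is every coordinate `wᵢ = ⟨w, eᵢ⟩`;
  have hdvd' : ∀ i, |a| ∣ w i := fun i => by
    simpa [dotWeight, Pi.single_apply] using hdvd (Pi.single i 1)
  -- `a ≠ 0` since `w ≠ 0`;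
  obtain ⟨i, hi⟩ := Function.ne_iff.mp hw
  have ha0 : a ≠ 0 := by
    rintro rfl
    have h0 := hdvd' i
    rw [abs_zero, zero_dvd_iff] at h0
    exact hi h0
  -- `|a|` itself is a weight `⟨w, v₀⟩`.
  obtain ⟨v₀, hv₀⟩ : |a| ∈ (dotWeightHom w).range := by
    rw [ha]
    exact abs_mem_iff.mpr (AddSubgroup.mem_closure_singleton_self a)
  have hscale : ∀ v, |a| * dotWeight (fun i => w i / |a|) v = dotWeight w v := fun v => by
    simp only [dotWeight_apply, Finset.mul_sum, ← mul_assoc, Int.mul_ediv_cancel' (hdvd' _)]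
  refine ⟨|a|, fun i => w i / |a|, v₀, abs_pos.mpr ha0, hscale, ?_⟩
  exact Int.eq_one_of_mul_eq_self_right (abs_pos.mpr ha0).ne' ((hscale v₀).trans hv₀)

/-- **Brick B6 — a nonzero weight is a positive multiple of the first coordinate of a lattice
splitting**: for `w ≠ 0` in `ℤ^n` there are an integer `ℓ > 0`, an abelian group `K` and an
isomorphism `e : ℤ^n ≃+ ℤ × K` with `ℓ · (e v).1 = ⟨w, v⟩` for all `v ∈ ℤ^n` (write `w = ℓ • w₀`
with `w₀` primitive and split off `⟨w₀, ·⟩`; `K = ker ⟨w₀, ·⟩`). [folklore] -/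
theorem tropicalLinks_exists_addEquiv_fst_eq_dotWeight : ∀ (n : ℕ) (w : Fin n → ℤ), w ≠ 0 → ∃ (ℓ : ℤ) (K : Type) (_ : AddCommGroup K) (e : (Fin n → ℤ) ≃+ ℤ × K), 0 < ℓ ∧ ∀ v : Fin n → ℤ, ℓ * (e v).1 = Literature.AlgebraicGeometry.Tropical.dotWeight w v := by
  intro n w hw
  obtain ⟨ℓ, w₀, v₀, hℓ, hscale, hv₀⟩ := tropicalLinks_exists_pos_mul_primitive_dotWeight hw
  obtain ⟨e, he⟩ := tropicalLinks_exists_addEquiv_prod_ker (dotWeightHom w₀) v₀ hv₀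
  exact ⟨ℓ, (dotWeightHom w₀).ker, inferInstance, e, hℓ, fun v => by
    rw [he, coe_dotWeightHom, hscale]⟩

end Summit.ResolutionOfSingularities.ResolutionOfSingularities.Theorems
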